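import Mathlib
import Summits.NavierStokesRegularity.NavierStokesRegularity.Theses.ExactWindowRungThree
import HarnessLib

/-!
# `ExactWindowRungThree.EnclosureGlueR` — the repaired-reach derivative-enclosure certificate implies
  the repaired exact-flow certificate (item stmt-NavierStokesRegularity-23955; glue of the gen-1 split
  of `ExactFlowCertificateR`)

**Statement.** `DerivativeEnclosureCertificateR → SegmentMeanValue → ExactFlowCertificateR`.

PROOF. Verbatim the landed proof of the unrepaired pair (`exactWindowRungThree_enclosureGlue_proof`,
Theorems/ExactWindowRungThreeEnclosureGlue.lean) with the two interval endpoints changed: the static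
clauses (PC1–PC3, WC, datum, MARGINS, DIST) are carried over; for the (EPOCH) clause at stage `j` and
polytope point `q` take `τq := τ j q`, `x := φ j q`:
* trajectory: the tube clause at `t = 0`, `z = q` now gives the window ODE derivative on
  `[0, τ j q − 0] = [0, τ j q]` directly;
* landing: base point + segment mean value along `σ ↦ yb_j + σ(q − yb_j)`, unchanged;
* bottom exit: verbatim;
* two trajectories: `y := φ j z`, `y' := φ j z'` exist on `[0, τ j q − t] ⊇ [0, u]` since the
  repaired reach is `t + u ≤ τ j q`, and the weighted Lipschitz bound is the segment-derivative budget
  (same reach) with `SegmentMeanValue`.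

HONEST FRAMING: pure bookkeeping between two certificate FORMATS for ONE Tao-type MODEL table; no
certificate is produced here, nothing about Navier–Stokes.
-/

noncomputable section

set_option linter.dupNamespace false

namespace Summit.NavierStokesRegularity.NavierStokesRegularity.Theorems

open Set

/-- **Item stmt-NavierStokesRegularity-23955** (`ExactWindowRungThree.EnclosureGlueR`): a
repaired-reach derivative-enclosure certificate plus the segment mean value inequality yield the
repaired exact-flow certificate (`x := φ j q`, `τq := τ j q`, `y := φ j z` on `[0, τ j q − t] ⊇ [0,u]`;
mean value along polytope and tube segments). [this file] -/
theorem exactWindowRungThree_enclosureGlueR_proof :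
    Summit.NavierStokesRegularity.NavierStokesRegularity.Theses.ExactWindowRungThree.EnclosureGlueR := by
  unfold Summit.NavierStokesRegularity.NavierStokesRegularity.Theses.ExactWindowRungThree.EnclosureGlueR
    Summit.NavierStokesRegularity.NavierStokesRegularity.Theses.ExactWindowRungThree.DerivativeEnclosureCertificateR
    Summit.NavierStokesRegularity.NavierStokesRegularity.Theses.ExactWindowRungThree.SegmentMeanValue
    Summit.NavierStokesRegularity.NavierStokesRegularity.Theses.ExactWindowRungThree.ExactFlowCertificateR
  intro hD hMV
  obtain ⟨R, θ, c, η₀, Cb, Cg, τs, mm, Kb, Ka, i₀, α, X₀, M, W, N₀, ℓ, ctr, rad, s, ω, Lv, as, κ, Λ, δ,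
    nx, φ, τ, yb, β, h1, h2, h3, h4, h5, h6, h7, h8, h9, h10, h11, h12, h13, h14, h15, h16, h17, h18,
    h19, h20, h21, h22, hdyn, hbase⟩ := hD
  refine ⟨R, θ, c, η₀, Cb, Cg, τs, mm, Kb, Ka, i₀, α, X₀, M, W, N₀, ℓ, ctr, rad, s, ω, Lv, as, κ, Λ,
    δ, nx, h1, h2, h3, h4, h5, h6, h7, h8, h9, h10, h11, h12, h13, h14, h15, h16, h17, h18, h19, h20,
    h21, h22, ?_⟩
  intro j hj q hq
  obtain ⟨-, -, -, hκ, -, -, hωpos, -⟩ := h22 j hj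
  obtain ⟨hτ0, hττ, has, hφq, hbot, htube, hlip⟩ := hdyn j hj q hq
  -- the tube clause applied to `q` itself at `t = 0`: horizon `[0, τ j q − 0] = [0, τ j q]`
  have hq0 : ∀ i k, -Kb ≤ k → k ≤ Ka → |q i k - φ j q i k 0| ≤ κ j * ω j k := by
    intro i k hk1 hk2
    rw [(hφq i k hk1 hk2).1, sub_self, abs_zero]
    exact (mul_pos hκ (hωpos k)).le
  have hself := htube 0 (left_mem_Icc.2 hτ0.le) q hq0
  simp only [sub_zero] at hself
  refine ⟨τ j q, φ j q, hτ0, hττ, has, ?_, ?_, hbot, ?_⟩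
  · -- the trajectory from `q`
    intro i k hk1 hk2
    exact ⟨(hφq i k hk1 hk2).1, fun t ht => ⟨((hself i k hk1 hk2).2 t ht).1, (hφq i k hk1 hk2).2 t ht⟩⟩
  · -- landing in the next polytope: base point + mean value along the segment `yb j → q`
    intro v hv l
    obtain ⟨-, hb⟩ := hbase j hj
    obtain ⟨hpt, hseg⟩ := hb v hv l
    obtain ⟨ψ, hψ⟩ := hseg q hq
    have hmv := hMV _ _ _ hψ
    simp only [one_smul, zero_smul, add_zero, add_sub_cancel] at hmv
    calc |ℓ (nx j) l (fun i k => Lv (nx j) *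
            (if k + 1 ≤ Ka then φ j q i (1 + k) (τ j q) else v i) / |φ j q i₀ 1 (τ j q)|) -
            ctr (nx j) l|
        ≤ |ℓ (nx j) l (fun i k => Lv (nx j) *
              (if k + 1 ≤ Ka then φ j q i (1 + k) (τ j q) else v i) / |φ j q i₀ 1 (τ j q)|) -
            ℓ (nx j) l (fun i k => Lv (nx j) *
              (if k + 1 ≤ Ka then φ j (yb j) i (1 + k) (τ j (yb j)) else v i) /
                |φ j (yb j) i₀ 1 (τ j (yb j))|)| +
          |ℓ (nx j) l (fun i k => Lv (nx j) *
              (if k + 1 ≤ Ka then φ j (yb j) i (1 + k) (τ j (yb j)) else v i) /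
                |φ j (yb j) i₀ 1 (τ j (yb j))|) - ctr (nx j) l| := abs_sub_le _ _ _
      _ ≤ β j l + |ℓ (nx j) l (fun i k => Lv (nx j) *
              (if k + 1 ≤ Ka then φ j (yb j) i (1 + k) (τ j (yb j)) else v i) /
                |φ j (yb j) i₀ 1 (τ j (yb j))|) - ctr (nx j) l| := by gcongr
      _ ≤ rad (nx j) l - s (nx j) l := by linarith
  · -- two trajectories from the tube, on `[0, u] ⊆ [0, τ j q − t]`: `y := φ j z`, `y' := φ j z'`
    intro t ht z z' d u hzz hu huτ
    refine ⟨φ j z, φ j z', fun i k hk1 hk2 => ?_⟩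
    have hz := htube t ht z (fun i k hk1 hk2 => (hzz i k hk1 hk2).1) i k hk1 hk2
    have hz' := htube t ht z' (fun i k hk1 hk2 => (hzz i k hk1 hk2).2.1) i k hk1 hk2
    have hIu : Icc (0 : ℝ) u ⊆ Icc 0 (τ j q - t) := Icc_subset_Icc_right (by linarith)
    refine ⟨hz.1, hz'.1, fun t' ht' => ⟨((hz.2 t' (hIu ht')).1).mono hIu,
      ((hz'.2 t' (hIu ht')).1).mono hIu, (hz.2 t' (hIu ht')).2, (hz'.2 t' (hIu ht')).2, ?_⟩⟩
    obtain ⟨ψ, hψ⟩ := hlip t ht z z' d u hzz hu huτ i k hk1 hk2 t' ht'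
    have hmv := hMV _ _ _ hψ
    simp only [one_smul, zero_smul, add_zero, add_sub_cancel] at hmv
    exact hmv

end Summit.NavierStokesRegularity.NavierStokesRegularity.Theorems

end
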